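import Literature.Combinatorics.Optimization.PentagonsPsdRankFour
import Literature.Combinatorics.Optimization.RegularPolygonPsdLifts
import Literature.Combinatorics.Optimization.CompletelyPsdRank
import HarnessLib

/-!
# Complex psd factorizations; the regular hexagon is `ℂ`-psd-minimal but not `ℝ`-psd-minimal
# (Goucha–Gouveia–Silva, *On ranks of regular polygons*, §4: Thm. 4.1, Thm. 4.2, Remark 4.8) — PROVED

Source. A. P. Goucha, J. Gouveia, P. M. Silva, *On ranks of regular polygons*, SIAM J. Discrete
Math. 31 (2017) 2612–2625 = arXiv:1610.09868 [GouchaGouveiaSilva2017] (held text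
`paper:arxiv-1610.09868`, p03 definitions, p09 §4). Verbatim: (p03) "a complex semidefinite
factorization is defined similarly with recourse to `A_i` and `B_j` complex semidefinite matrices …
the complex semidefinite rank of `M`, `rank_psd^ℂ(M)`, is the smallest size of a … complex
semidefinite factorization"; (p04) "`rank_psd^ℂ(M) ≤ rank_psd(M)`"; (p09) **Theorem 4.1** "Let `S_P` be
the slack matrix of a `d`-polytope `P`. Then `rank_psd^ℂ S_P ≥ d+1`." **Theorem 4.2** "A `d`-polytope
`P` with slack matrix `S_P` is `ℂ`-psd-minimal if and only if there exists a matrix `M ∈ ℂ^{f×v}` with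
`rank M = d+1` such that `S_P = |M| ⊙ |M|`." **Remark 4.8** "if one considers the slack matrix of the
regular hexagon `S_P`, it is possible to find a matrix `M ∈ ℂ^{6×6}` with `rank M = 3` such that
`S_P = |M| ⊙ |M|` … this polygon is `ℂ`-psd-minimal. The matrices `S_P` and `M` are: [printed]. In
fact, this is contrary to what happens in the real case where the psd-minimal polygons are just
triangles and quadrilaterals." (Real side in the tree: GRT 2013 Thm. 4.7 and GRT 2015 Thm. 3.4 —
every convex hexagon has real psd rank exactly `4`, `IsConvexPolygon.psdRank_hexagon`.)

Contents (all PROVED; one new definition, no named facts):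
* `HasComplexPsdFactorization M r` — the definition of p03 (Hermitian psd `r × r` complex factors,
  `M_{ij} = tr(A_i B_j)`; the shape of the inline hypothesis of `LeeWeiDeWolf2017_thm19`);
  `HasPsdFactorization.toComplex` (p04: `rank_psd^ℂ ≤ rank_psd`; a real symmetric psd matrix is
  Hermitian psd over `ℂ`, `x^*Xx = aᵀXa + bᵀXb`).
* `HasComplexPsdFactorization.of_normSq` — the construction in **Thm. 4.2** (complex FGPRT
  Thm. 2.9 (v)): `M_{ij} = |u_i · v_j|²` through `ℂ^k` gives the size-`k` factorization
  `A_i = ū_i u_iᵀ`, `B_j = v_j v_j^*`.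
* `HasComplexPsdFactorization.card_le_of_triangular` (complex psd fooling-set bound, via
  `tr(PQ) = 0 ⇒ PQ = 0` for Hermitian psd `P, Q`) and **Thm. 4.1 for `d = 2`**:
  `IsConvexPolygon.three_le_of_hasComplexPsdFactorization` (every convex polygon has complex psd
  rank `≥ 3`).
* **Remark 4.8**: `hexVertex` = the lattice hexagon `conv{±e₁, ±e₂, ±(e₁+e₂)}` (vertices
  `(1,0),(1,1),(0,1),(−1,0),(−1,−1),(0,−1)`), an AFFINE image of the regular hexagon whose
  vertex/edge slack matrix is EXACTLY the printed integer matrix `S_P` (`ggsHexSlack`, columns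
  shifted by one: `polygonSlack_hexVertex`) — a recorded substitution that avoids trigonometric
  coordinates (psd ranks of slack matrices are affine invariants); `ggsHexM` = the printed `M`,
  `normSq_ggsHexM` (`S_P = |M| ⊙ |M|`), `ggsHexM_eq_sum` (`M = C · M[rows 0,1,2]` with the explicit
  `C = ggsHexC` over `ℤ[√2, i]`, so `rank M ≤ 3`), `hasComplexPsdFactorization_hexVertex_three`, and
  the headline `GouchaGouveiaSilva2017_rem48`: complex psd rank EXACTLY `3`, real psd rank EXACTLY `4`.

NOT here: Thm. 4.1/4.2 for `d ≥ 3` and the "only if"/rank-one half of Thm. 4.2 (GRT13 Thm. 3.5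
over `ℂ`); Lemma 4.5–Cor. 4.7 (the regular pentagon and `n`-gons that are not `ℂ`-psd-minimal,
via symbolic slack matrices); §§2–3 (nonnegative rank and equivariant psd rank of regular polygons).

* (appended) the Euclidean regular hexagon `X_6` of `RegularPolygonPsdLifts.lean`: `hexShear`
  (`x_k = A v_k`, `RegularPolygon.vertex_six_eq`, `det A = √3/2`), `polygonSlack_mulVec` (a linear
  map scales slack matrices by its determinant), `RegularPolygon.polygonSlack_vertex_six`, and
  `RegularPolygon.regularHexagon_complexPsdRank` (Remark 4.8 for `X_6` itself: complex psd rank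
  exactly `3`, real exactly `4`).
* (appended) basic API of `HasComplexPsdFactorization`: `transpose`, `submatrix`, the dimension bound
  `rank_le_sq` (`rank M ≤ r²`: Lee–Wei–de Wolf [LeeWeiDeWolf2017] Fact 4, p05, "`rank_psd(A) ≥ √rank(A)`",
  through the `r²` real coordinates of a Hermitian matrix) and the realification `toReal`
  (`rank_psd^ℝ ≤ 2 rank_psd^ℂ`, LWdW p03, through the tree's realification `T(H) = [[Re H, −Im H],
  [Im H, Re H]]` of `CompletelyPsdRank.lean`: `posSemidef_realify`, `trace_realify_mul_realify`).
* (appended) **FGPRT §2.2** [FawziEtAl2015] (p06): the printed Hermitian factorization of size `2` of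
  the `4 × 4` derangement matrix (`derangementRowVec`, `derangementColVec`, `omega3 = e^{2πi/3}`,
  `derangementMatrix_four_eq_normSq`), hence `rank_psd^ℂ(D_4) = 2 < 3 = rank_psd(D_4)`
  (`FawziEtAl2015_sec22_derangement`, the real side from `FawziEtAl2015_ex51_holds`).
-/

noncomputable section

open Matrix Finset
open scoped MatrixOrder ComplexOrder

namespace Literature.Combinatorics.Optimization

/-! ### Complex positive semidefinite factorizations -/

/-- **Complex semidefinite factorization** (GGS p03, verbatim: "a complex semidefinite factorization is
defined similarly with recourse to `A_i` and `B_j` complex semidefinite matrices. Here the inner product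
considered is the usual trace product `⟨A,B⟩ = tr(B^*A)`"; for Hermitian `B`, `tr(B^*A) = tr(AB)`):
`M` has a factorization `M_{ij} = tr(A_i B_j)` with `A_i, B_j` HERMITIAN positive semidefinite `r × r`
complex matrices; `rank_psd^ℂ(M)` is the least such `r`. (Same shape as the tree's real
`HasPsdFactorization` and as the inline hypothesis of `LeeWeiDeWolf2017_thm19`.)
[cite: GouchaGouveiaSilva2017, §1 (p03)] -/
def HasComplexPsdFactorization {ι κ : Type*} (M : ι → κ → ℝ) (r : ℕ) : Prop :=
  ∃ (A : ι → Matrix (Fin r) (Fin r) ℂ) (B : κ → Matrix (Fin r) (Fin r) ℂ),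
    (∀ i, (A i).PosSemidef) ∧ (∀ j, (B j).PosSemidef) ∧ ∀ i j, ((M i j : ℝ) : ℂ) = (A i * B j).trace

/-- A real symmetric psd matrix is a complex Hermitian psd matrix (entries cast to `ℂ`):
`x^* X x = aᵀXa + bᵀXb ≥ 0` for `x = a + ib`. [folklore] -/
private theorem posSemidef_map_ofReal {n : Type*} [Fintype n] {X : Matrix n n ℝ}
    (hX : X.PosSemidef) : (X.map ((↑) : ℝ → ℂ)).PosSemidef := by
  classical
  have hsym : ∀ i j, X j i = X i j := fun i j => by
    simpa using hX.isHermitian.apply i j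
  refine PosSemidef.of_dotProduct_mulVec_nonneg ?_ fun x => ?_
  · ext i j
    simp [conjTranspose_apply, hsym i j]
  · have ha : 0 ≤ (fun i => (x i).re) ⬝ᵥ X *ᵥ (fun i => (x i).re) := by
      simpa using hX.dotProduct_mulVec_nonneg (fun i => (x i).re)
    have hb : 0 ≤ (fun i => (x i).im) ⬝ᵥ X *ᵥ (fun i => (x i).im) := by
      simpa using hX.dotProduct_mulVec_nonneg (fun i => (x i).im)
    -- real and imaginary parts of `x^* X x`
    have hre : (star x ⬝ᵥ (X.map ((↑) : ℝ → ℂ)) *ᵥ x).re =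
        ∑ i, ∑ j, X i j * ((x i).re * (x j).re + (x i).im * (x j).im) := by
      simp only [dotProduct, mulVec, map_apply, Complex.re_sum, Pi.star_apply, Complex.mul_re,
        Complex.star_def, Complex.conj_re, Complex.conj_im, Complex.ofReal_re, Complex.ofReal_im,
        Complex.mul_im, zero_mul, add_zero, sub_zero, Finset.mul_sum]
      refine Finset.sum_congr rfl fun i _ => Finset.sum_congr rfl fun j _ => ?_
      ring
    have hab : (fun i => (x i).re) ⬝ᵥ X *ᵥ (fun i => (x i).re) + (fun i => (x i).im) ⬝ᵥ X *ᵥ (fun i => (x i).im) =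
        ∑ i, ∑ j, X i j * ((x i).re * (x j).re + (x i).im * (x j).im) := by
      simp only [dotProduct, mulVec, Finset.mul_sum, ← Finset.sum_add_distrib]
      refine Finset.sum_congr rfl fun i _ => Finset.sum_congr rfl fun j _ => ?_
      ring
    have him : (star x ⬝ᵥ (X.map ((↑) : ℝ → ℂ)) *ᵥ x).im = 0 := by
      have h1 : (star x ⬝ᵥ (X.map ((↑) : ℝ → ℂ)) *ᵥ x).im =
          ∑ i, ∑ j, X i j * ((x i).re * (x j).im - (x i).im * (x j).re) := by
        simp only [dotProduct, mulVec, map_apply, Complex.im_sum, Pi.star_apply, Complex.mul_im,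
          Complex.star_def, Complex.conj_re, Complex.conj_im, Complex.ofReal_re, Complex.ofReal_im,
          Complex.mul_re, zero_mul, add_zero, sub_zero, Finset.mul_sum]
        refine Finset.sum_congr rfl fun i _ => Finset.sum_congr rfl fun j _ => ?_
        ring
      -- the double sum is antisymmetric under `i ↔ j` (by the symmetry of `X`), hence zero
      have h2 : ∑ i, ∑ j, X i j * ((x i).re * (x j).im - (x i).im * (x j).re) =
          -∑ i, ∑ j, X i j * ((x i).re * (x j).im - (x i).im * (x j).re) := by
        conv_rhs => rw [Finset.sum_comm]
        rw [← Finset.sum_neg_distrib]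
        refine Finset.sum_congr rfl fun i _ => ?_
        rw [← Finset.sum_neg_distrib]
        refine Finset.sum_congr rfl fun j _ => ?_
        rw [hsym j i]
        ring
      rw [h1]
      linarith
    rw [Complex.nonneg_iff, hre, him, ← hab]
    exact ⟨add_nonneg ha hb, rfl⟩

/-- `rank_psd^ℂ ≤ rank_psd` (GGS p04: "`rank_psd^ℂ(M) ≤ rank_psd(M)`"): a real psd factorization is a
complex one (real symmetric psd matrices are Hermitian psd). [cite: GouchaGouveiaSilva2017, §1 (p04)] -/
theorem HasPsdFactorization.toComplex {ι κ : Type*} {M : ι → κ → ℝ} {r : ℕ}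
    (h : HasPsdFactorization M r) : HasComplexPsdFactorization M r := by
  obtain ⟨A, B, hA, hB, hM⟩ := h
  refine ⟨fun i => (A i).map (↑), fun j => (B j).map (↑), fun i => posSemidef_map_ofReal (hA i),
    fun j => posSemidef_map_ofReal (hB j), fun i j => ?_⟩
  change ((M i j : ℝ) : ℂ) = ((A i).map ((↑) : ℝ → ℂ) * (B j).map ((↑) : ℝ → ℂ)).trace
  rw [hM i j]
  simp [trace, Matrix.mul_apply]

/-- **GGS Theorem 4.2, the construction** (p09: "`S_P = |M| ⊙ |M|` with `rank M = d+1`" gives a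
complex factorization of size `d+1`; the complex analogue of FGPRT Thm. 2.9 (v)): if
`M_{ij} = |u_i · v_j|²` for vectors `u_i, v_j ∈ ℂ^k`, then `A_i = \bar u_i u_iᵀ`, `B_j = v_j v_j^*` is
a complex psd factorization of size `k`. [cite: GouchaGouveiaSilva2017, Thm. 4.2 (p09)] -/
theorem HasComplexPsdFactorization.of_normSq {ι κ : Type*} {M : ι → κ → ℝ} {k : ℕ}
    (u : ι → Fin k → ℂ) (v : κ → Fin k → ℂ) (h : ∀ i j, M i j = Complex.normSq (u i ⬝ᵥ v j)) :
    HasComplexPsdFactorization M k := by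
  refine ⟨fun i => vecMulVec (star (u i)) (u i), fun j => vecMulVec (v j) (star (v j)),
    fun i => ?_, fun j => posSemidef_vecMulVec_self_star (v j), fun i j => ?_⟩
  · simpa using posSemidef_vecMulVec_self_star (star (u i))
  · change ((M i j : ℝ) : ℂ) = (vecMulVec (star (u i)) (u i) * vecMulVec (v j) (star (v j))).trace
    rw [h i j, vecMulVec_mul_vecMulVec, trace_vecMulVec, dotProduct_smul, star_dotProduct_star,
      dotProduct_comm (v j) (u i), smul_eq_mul, Complex.star_def, Complex.mul_conj]

/-! ### The hexagon `conv{±e₁, ±e₂, ±(e₁+e₂)}` (an affine regular hexagon) -/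

/-- The vertices `(1,0),(1,1),(0,1),(−1,0),(−1,−1),(0,−1)` (counterclockwise) of the lattice hexagon
`conv{±e₁, ±e₂, ±(e₁+e₂)}`, an affine image of the regular hexagon; its vertex/edge slack matrix is
the printed `S_P` of GGS Remark 4.8 (up to the column shift `j ↦ j+1`). [cite: GouchaGouveiaSilva2017, Rem. 4.8 (p09)] -/
def hexVertex : Fin 6 → (Fin 2 → ℝ) := ![![1, 0], ![1, 1], ![0, 1], ![-1, 0], ![-1, -1], ![0, -1]]

/-- GGS's slack matrix of the regular hexagon (p09, verbatim rows):
`[[0,0,1,2,2,1],[1,0,0,1,2,2],[2,1,0,0,1,2],[2,2,1,0,0,1],[1,2,2,1,0,0],[0,1,2,2,1,0]]`.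
[cite: GouchaGouveiaSilva2017, Rem. 4.8 (p09)] -/
def ggsHexSlack : Fin 6 → Fin 6 → ℝ :=
  ![![0, 0, 1, 2, 2, 1], ![1, 0, 0, 1, 2, 2], ![2, 1, 0, 0, 1, 2], ![2, 2, 1, 0, 0, 1],
    ![1, 2, 2, 1, 0, 0], ![0, 1, 2, 2, 1, 0]]

/-- GGS's complex matrix `M` with `S_P = |M| ⊙ |M|` and `rank M = 3` (p09, verbatim).
[cite: GouchaGouveiaSilva2017, Rem. 4.8 (p09)] -/
def ggsHexM : Fin 6 → Fin 6 → ℂ :=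
  ![![0, 0, 1, (Real.sqrt 2 : ℂ), (Real.sqrt 2 : ℂ), 1],
    ![1, 0, 0, 1, 1 - Complex.I, (Real.sqrt 2 : ℂ)],
    ![1 + Complex.I, 1, 0, 0, 1, (Real.sqrt 2 : ℂ) * Complex.I],
    ![(Real.sqrt 2 : ℂ) * Complex.I, (Real.sqrt 2 : ℂ) * Complex.I, -1, 0, 0, -1],
    ![1, 1 + Complex.I, (Real.sqrt 2 : ℂ) * Complex.I, 1, 0, 0],
    ![0, 1, (Real.sqrt 2 : ℂ), 1 - Complex.I, 1, 0]]

/-- The slack matrix of the lattice hexagon IS the printed `S_P`, columns shifted by one (column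
`j` of `S_P` vanishes at the vertices `j−1, j`; the tree's edge `j` runs from `x_j` to `x_{j+1}`).
[cite: GouchaGouveiaSilva2017, Rem. 4.8 (p09)] -/
theorem polygonSlack_hexVertex (i j : Fin 6) : polygonSlack hexVertex i j = ggsHexSlack i (j + 1) := by
  fin_cases i <;> fin_cases j <;> simp [polygonSlack_apply, hexVertex, ggsHexSlack] <;> norm_num

/-- The lattice hexagon is a convex hexagon. [cite: GouchaGouveiaSilva2017, Rem. 4.8 (p09)] -/
theorem isConvexPolygon_hexVertex : IsConvexPolygon hexVertex := by
  intro i j hij hij1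
  rw [polygonSlack_hexVertex]
  fin_cases i <;> fin_cases j <;> simp_all [ggsHexSlack]

/-- `S_P = |M| ⊙ |M|` entrywise (p09). [cite: GouchaGouveiaSilva2017, Rem. 4.8 (p09)] -/
theorem normSq_ggsHexM (i j : Fin 6) : Complex.normSq (ggsHexM i j) = ggsHexSlack i j := by
  have h2 : Complex.normSq (Real.sqrt 2 : ℂ) = 2 := by
    rw [Complex.normSq_ofReal, Real.mul_self_sqrt (by norm_num)]
  have h1i : Complex.normSq (1 + Complex.I) = 2 := by
    have := Complex.normSq_add_mul_I 1 1
    norm_num at this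
    exact this
  have h1i' : Complex.normSq (1 - Complex.I) = 2 := by
    have := Complex.normSq_add_mul_I 1 (-1)
    norm_num at this
    simpa [sub_eq_add_neg] using this
  fin_cases i <;> fin_cases j <;> simp [ggsHexM, ggsHexSlack, Complex.normSq_mul, h2, h1i, h1i']

/-- The coefficient matrix `C` expressing the rows of `M` in its first three rows: `M = C · M[0..2,:]`
(so `rank M = 3`). [cite: GouchaGouveiaSilva2017, Rem. 4.8 (p09)] -/
def ggsHexC : Fin 6 → Fin 3 → ℂ :=
  ![![1, 0, 0], ![0, 1, 0], ![0, 0, 1],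
    ![-1, (Real.sqrt 2 : ℂ), (Real.sqrt 2 : ℂ) * Complex.I],
    ![(Real.sqrt 2 : ℂ) * Complex.I, 1 - 2 * Complex.I, 1 + Complex.I],
    ![(Real.sqrt 2 : ℂ), -1 - Complex.I, 1]]

/-- The first three rows of `M`. [cite: GouchaGouveiaSilva2017, Rem. 4.8 (p09)] -/
def ggsHexR : Fin 3 → Fin 6 → ℂ := fun k j => ggsHexM (Fin.castLE (by norm_num) k) j

/-- **`rank M = 3`, explicitly**: `M_{ij} = Σ_k C_{ik} M_{kj}` (`k < 3`).
[cite: GouchaGouveiaSilva2017, Rem. 4.8 (p09)] -/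
theorem ggsHexM_eq_sum (i j : Fin 6) : ggsHexM i j = ggsHexC i ⬝ᵥ fun k => ggsHexR k j := by
  have hs : (Real.sqrt 2 : ℂ) ^ 2 = 2 := by
    rw [← Complex.ofReal_pow, Real.sq_sqrt (by norm_num)]; norm_num
  fin_cases i <;> fin_cases j <;>
    simp [ggsHexM, ggsHexC, ggsHexR, dotProduct, Fin.sum_univ_three, Fin.castLE] <;> ring_nf <;>
    simp [Complex.I_sq, hs] <;> ring_nf

/-! ### The complex psd fooling-set bound and GGS Theorem 4.1 for polygons -/

/-- `Tr(P Q) = 0` forces `P Q = 0` for Hermitian psd complex `P, Q` (write `Q = CᴴC`; then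
`Tr(P CᴴC) = Σ_l c̄_lᵀ P c̄_l` with nonnegative terms). [folklore] -/
private theorem mul_eq_zero_of_posSemidef_trace_eq_zero_complex' {d : ℕ}
    {P Q : Matrix (Fin d) (Fin d) ℂ} (hP : P.PosSemidef) (hQ : Q.PosSemidef)
    (h : (P * Q).trace = 0) : P * Q = 0 := by
  classical
  obtain ⟨C, hC⟩ := CStarAlgebra.nonneg_iff_eq_star_mul_self.mp hQ.nonneg
  have hQC : Q = Cᴴ * C := by rw [hC, star_eq_conjTranspose]
  have hsum : (P * Q).trace = ∑ l, star (star (C l)) ⬝ᵥ (P *ᵥ star (C l)) := by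
    rw [hQC, ← Matrix.mul_assoc, Matrix.trace_mul_comm]
    simp only [Matrix.trace, Matrix.diag_apply, Matrix.mul_apply, Matrix.conjTranspose_apply,
      dotProduct, Matrix.mulVec, Finset.mul_sum, star_star, Pi.star_apply]
  have hnn : ∀ l, 0 ≤ star (star (C l)) ⬝ᵥ (P *ᵥ star (C l)) := fun l =>
    hP.dotProduct_mulVec_nonneg (star (C l))
  have hzero : ∀ l, star (star (C l)) ⬝ᵥ (P *ᵥ star (C l)) = 0 := by
    have h0 : ∑ l, star (star (C l)) ⬝ᵥ (P *ᵥ star (C l)) = 0 := by rw [← hsum, h]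
    exact fun l => (Finset.sum_eq_zero_iff_of_nonneg fun l _ => hnn l).1 h0 l (Finset.mem_univ l)
  have hker : ∀ l, P *ᵥ star (C l) = 0 := fun l => (hP.dotProduct_mulVec_zero_iff _).1 (hzero l)
  have hPCh : P * Cᴴ = 0 := by
    ext s l
    have := congrFun (hker l) s
    simpa only [Matrix.mul_apply, Matrix.conjTranspose_apply, Matrix.mulVec, dotProduct,
      Matrix.zero_apply, Pi.zero_apply, Pi.star_apply] using this
  rw [hQC, ← Matrix.mul_assoc, hPCh, Matrix.zero_mul]

/-- **The psd fooling-set bound, complex form** (the argument of GRT13 Prop. 3.2 / FGPRT Thm. 2.10,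
which GGS Thm. 4.1 says carries over verbatim: "The proofs are omitted since they are virtually the
same"): a complex psd factorization of size `k` of a matrix containing a `K × K` triangular pattern
`M (ρ a) (γ a) ≠ 0`, `M (ρ a) (γ b) = 0` (`a < b`) has `K ≤ k`. [cite: GouchaGouveiaSilva2017, Thm. 4.1 (p09)] -/
theorem HasComplexPsdFactorization.card_le_of_triangular {ι κ : Type*} {M : ι → κ → ℝ} {k K : ℕ}
    (h : HasComplexPsdFactorization M k) (ρ : Fin K → ι) (γ : Fin K → κ)
    (hdiag : ∀ a, M (ρ a) (γ a) ≠ 0) (hoff : ∀ a b, a < b → M (ρ a) (γ b) = 0) : K ≤ k := by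
  classical
  obtain ⟨A, B, hA, hB, hM⟩ := h
  have horth : ∀ a b, a < b → A (ρ a) * B (γ b) = 0 := fun a b hab =>
    mul_eq_zero_of_posSemidef_trace_eq_zero_complex' (hA _) (hB _)
      (by rw [← hM]; exact_mod_cast hoff a b hab)
  have hex : ∀ a, ∃ st : Fin k × Fin k, (A (ρ a) * B (γ a)) st.1 st.2 ≠ 0 := by
    intro a
    by_contra! hzero
    refine hdiag a ?_
    have h0 : ((M (ρ a) (γ a) : ℝ) : ℂ) = 0 := by
      rw [hM, show A (ρ a) * B (γ a) = 0 from Matrix.ext fun s t => hzero ⟨s, t⟩, trace_zero]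
    exact_mod_cast h0
  choose st hst using hex
  let v : Fin K → (Fin k → ℂ) := fun a s => B (γ a) s (st a).2
  let φ : Fin K → (Fin k → ℂ) →ₗ[ℂ] ℂ := fun a =>
    (LinearMap.proj (st a).1).comp (Matrix.mulVecLin (A (ρ a)))
  have hφ : ∀ a b, φ a (v b) = (A (ρ a) * B (γ b)) (st a).1 (st b).2 := by
    intro a b
    simp [φ, v, mul_apply, mulVec, dotProduct]
  have hli : LinearIndependent ℂ v := by
    rw [Fintype.linearIndependent_iff]
    intro c hc
    by_contra! hne
    obtain ⟨a₀, ha₀⟩ := hne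
    set s : Finset (Fin K) := univ.filter fun a => c a ≠ 0 with hs
    have hsne : s.Nonempty := ⟨a₀, by simp [hs, ha₀]⟩
    set a := s.min' hsne with ha
    have hca : c a ≠ 0 := by
      have hmem := s.min'_mem hsne
      rw [← ha] at hmem
      simpa [hs] using hmem
    have hlt : ∀ b, b < a → c b = 0 := by
      intro b hba
      by_contra hcb
      exact absurd (s.min'_le b (by simp [hs, hcb])) (not_le.mpr (ha ▸ hba))
    have happ := congrArg (φ a) hc
    rw [map_sum, map_zero, Finset.sum_eq_single a] at happ
    · rw [map_smul, smul_eq_mul, hφ] at happ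
      exact hca ((mul_eq_zero.1 happ).resolve_right (hst a))
    · intro b _ hba
      rcases lt_or_gt_of_ne hba with hba' | hab'
      · rw [hlt b hba', zero_smul, map_zero]
      · rw [map_smul, hφ, horth a b hab', smul_eq_mul]
        simp
    · simp
  simpa using hli.fintype_card_le_finrank

section Polygon

variable {m : ℕ} [NeZero m]

/-- Index `t < m` as an element of `Fin m`. [folklore] -/
private def idx' (t : ℕ) (ht : t < m) : Fin m := ⟨t, ht⟩

/-- Successor of an index below the top. [folklore] -/
private theorem idx'_succ {t : ℕ} (ht : t + 1 < m) : (idx' t (by omega) + 1 : Fin m) = idx' (t + 1) ht := by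
  ext; simp [idx', Fin.val_add, Nat.mod_eq_of_lt ht]

omit [NeZero m] in
/-- Distinct naturals give distinct indices. [folklore] -/
private theorem idx'_ne {s t : ℕ} (hs : s < m) (ht : t < m) (h : s ≠ t) : idx' s hs ≠ idx' t ht := by
  simpa [idx', Fin.ext_iff] using h

/-- **GGS Theorem 4.1 for polygons** (p09, verbatim: "Let `S_P` be the slack matrix of a `d`-polytope
`P`. Then `rank_psd^ℂ S_P ≥ d+1`"; here `d = 2`): every COMPLEX psd factorization of the slack matrix
of a convex polygon has size `≥ 3` — the same triangular pattern (rows `x₁, x₂, x₀`, edges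
`[x₂,x₃], [x₀,x₁], [x₁,x₂]`) as in the real case `IsConvexPolygon.three_le_of_hasPsdFactorization`.
[cite: GouchaGouveiaSilva2017, Thm. 4.1 (p09)] -/
theorem IsConvexPolygon.three_le_of_hasComplexPsdFactorization {x : Fin m → (Fin 2 → ℝ)}
    (hx : IsConvexPolygon x) (hm : 3 ≤ m) {k : ℕ}
    (hk : HasComplexPsdFactorization (polygonSlack x) k) : 3 ≤ k := by
  have h0 : (0:ℕ) < m := by omega
  have h1 : (1:ℕ) < m := by omega
  have h2 : (2:ℕ) < m := by omega
  have n12 : polygonSlack x (idx' 1 h1) (idx' 2 h2) ≠ 0 := by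
    refine (hx _ _ (idx'_ne h1 h2 (by norm_num)) fun he => ?_).ne'
    have := congrArg Fin.val he
    rw [Fin.val_add, Fin.val_one'] at this
    simp [idx'] at this
    rcases Nat.lt_or_ge 3 m with h3 | h3
    · rw [Nat.mod_eq_of_lt h3] at this; omega
    · have hm3 : m = 3 := by omega
      subst hm3; simp at this
  have n20 : polygonSlack x (idx' 2 h2) (idx' 0 h0) ≠ 0 :=
    (hx _ _ (idx'_ne h2 h0 (by norm_num)) (by rw [idx'_succ h1]; exact idx'_ne h2 h1 (by norm_num))).ne'
  have n01 : polygonSlack x (idx' 0 h0) (idx' 1 h1) ≠ 0 :=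
    (hx _ _ (idx'_ne h0 h1 (by norm_num)) (by rw [idx'_succ h2]; exact idx'_ne h0 h2 (by norm_num))).ne'
  refine hk.card_le_of_triangular ![idx' 1 h1, idx' 2 h2, idx' 0 h0] ![idx' 2 h2, idx' 0 h0, idx' 1 h1]
    (fun a => by fin_cases a <;> assumption) (fun a b hab => ?_)
  fin_cases a <;> fin_cases b <;> simp at hab ⊢
  · rw [← idx'_succ h1, polygonSlack_succ]
  · rw [← idx'_succ h2, polygonSlack_succ]

end Polygon

/-! ### GGS Remark 4.8: the hexagon is `ℂ`-psd-minimal but not `ℝ`-psd-minimal -/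

/-- `S_P = |M| ⊙ |M|` with `M = C · M[0..2,:]` of rank `3`: the printed `S_P` has a COMPLEX psd
factorization of size `3`. [cite: GouchaGouveiaSilva2017, Rem. 4.8 (p09)] -/
theorem hasComplexPsdFactorization_ggsHexSlack_three : HasComplexPsdFactorization ggsHexSlack 3 :=
  HasComplexPsdFactorization.of_normSq ggsHexC (fun j k => ggsHexR k j) fun i j => by
    rw [← normSq_ggsHexM, ggsHexM_eq_sum]

/-- The lattice hexagon's slack matrix has a complex psd factorization of size `3` (columns of
`S_P` shifted). [cite: GouchaGouveiaSilva2017, Rem. 4.8 (p09)] -/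
theorem hasComplexPsdFactorization_hexVertex_three :
    HasComplexPsdFactorization (polygonSlack hexVertex) 3 := by
  obtain ⟨A, B, hA, hB, h⟩ := hasComplexPsdFactorization_ggsHexSlack_three
  exact ⟨A, fun j => B (j + 1), hA, fun j => hB _, fun i j => by rw [polygonSlack_hexVertex]; exact h i _⟩

/-- **GGS Remark 4.8** (p09, verbatim: "if one considers the slack matrix of the regular hexagon
`S_P`, it is possible to find a matrix `M ∈ ℂ^{6×6}` with `rank M = 3` such that `S_P = |M| ⊙ |M|` …
this polygon is `ℂ`-psd-minimal … contrary to what happens in the real case where the psd-minimal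
polygons are just triangles and quadrilaterals"): for the (affinely) regular hexagon
`conv{±e₁, ±e₂, ±(e₁+e₂)}` the complex psd rank of the slack matrix is EXACTLY `3 = d + 1`
(size `3`: the printed `M`; no smaller: Thm. 4.1) while its real psd rank is EXACTLY `4` (GRT 2015
Thm. 3.4 and GRT 2013 Thm. 4.7, `IsConvexPolygon.psdRank_hexagon`) — a polytope separating real
from complex psd rank / semidefinite extension complexity. [cite: GouchaGouveiaSilva2017, Rem. 4.8 (p09)] -/
theorem GouchaGouveiaSilva2017_rem48 :
    (HasComplexPsdFactorization (polygonSlack hexVertex) 3 ∧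
      ¬ HasComplexPsdFactorization (polygonSlack hexVertex) 2) ∧
    (HasPsdFactorization (polygonSlack hexVertex) 4 ∧ ¬ HasPsdFactorization (polygonSlack hexVertex) 3) :=
  ⟨⟨hasComplexPsdFactorization_hexVertex_three, fun h =>
      absurd (isConvexPolygon_hexVertex.three_le_of_hasComplexPsdFactorization (by norm_num) h)
        (by norm_num)⟩,
    isConvexPolygon_hexVertex.psdRank_hexagon⟩


/-! ### The Euclidean regular hexagon `X_6` (appended): Remark 4.8 as printed -/

section RegularHexagon

open Real

/-- `det(A u, A v) = det A · det(u, v)` for a `2 × 2` matrix `A` (slack matrices of affinely equivalent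
polygons agree up to a positive factor). [cite: GouchaGouveiaSilva2017, §1 (p03, "defined only up to scaling")] -/
theorem cross2_mulVec (A : Matrix (Fin 2) (Fin 2) ℝ) (u v : Fin 2 → ℝ) :
    cross2 (A *ᵥ u) (A *ᵥ v) = A.det * cross2 u v := by
  simp [cross2, mulVec, dotProduct, Fin.sum_univ_two, Matrix.det_fin_two]
  ring

/-- A linear map multiplies every entry of the vertex/edge slack matrix by its determinant (psd
ranks of polygons are affine invariants). [cite: GouchaGouveiaSilva2017, §1 (p03)] -/
theorem polygonSlack_mulVec {m : ℕ} [NeZero m] (A : Matrix (Fin 2) (Fin 2) ℝ)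
    (x : Fin m → (Fin 2 → ℝ)) (i j : Fin m) :
    polygonSlack (fun k => A *ᵥ x k) i j = A.det * polygonSlack x i j := by
  simp only [polygonSlack, Matrix.of_apply, ← mulVec_sub, cross2_mulVec]

/-- The linear map taking the lattice hexagon to the regular hexagon `X_6` (columns: the images
`(cos 30°, sin 30°)` of `e₁` and `(cos 150°, sin 150°)` of `e₂`; determinant `√3/2`).
[cite: FawziSaundersonParrilo2014, §1.3 (p04, the vertices `(cos θ_i, sin θ_i)`)] -/
def hexShear : Matrix (Fin 2) (Fin 2) ℝ := !![Real.sqrt 3 / 2, -(Real.sqrt 3 / 2); 1 / 2, 1 / 2]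

/-- `det A = √3/2 > 0`. [cite: FawziSaundersonParrilo2014, §1.3 (p04)] -/
theorem det_hexShear : hexShear.det = Real.sqrt 3 / 2 := by
  simp [hexShear, Matrix.det_fin_two]; ring

/-- **The regular hexagon is the image of the lattice hexagon**: `x_k = A v_k` for the tree's
`RegularPolygon.vertex 6` (vertex angles `30°, 90°, …, 330°`). [cite: FawziSaundersonParrilo2014, §1.3 (p04)] -/
theorem RegularPolygon.vertex_six_eq (k : Fin 6) : RegularPolygon.vertex 6 k = hexShear *ᵥ hexVertex k := by
  have hc6 : cos (π / 6) = Real.sqrt 3 / 2 := Real.cos_pi_div_six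
  have hs6 : sin (π / 6) = 1 / 2 := Real.sin_pi_div_six
  have e0 : RegularPolygon.vertexAngle 6 0 = π / 6 := by simp [RegularPolygon.vertexAngle]
  have e1 : RegularPolygon.vertexAngle 6 1 = π / 2 := by simp [RegularPolygon.vertexAngle]; ring
  have e2 : RegularPolygon.vertexAngle 6 2 = π - π / 6 := by simp [RegularPolygon.vertexAngle]; ring
  have e3 : RegularPolygon.vertexAngle 6 3 = π / 6 + π := by simp [RegularPolygon.vertexAngle]; ring
  have e4 : RegularPolygon.vertexAngle 6 4 = π / 2 + π := by simp [RegularPolygon.vertexAngle]; ring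
  have e5 : RegularPolygon.vertexAngle 6 5 = -(π / 6) + 2 * π := by simp [RegularPolygon.vertexAngle]; ring
  fin_cases k
  · ext t; fin_cases t <;> simp [RegularPolygon.vertex, e0, hc6, hs6, hexShear, hexVertex, mulVec, dotProduct, Fin.sum_univ_two]
  · ext t; fin_cases t <;> simp [RegularPolygon.vertex, e1, hexShear, hexVertex, mulVec, dotProduct, Fin.sum_univ_two]; ring
  · ext t; fin_cases t <;> simp [RegularPolygon.vertex, e2, Real.cos_pi_sub, Real.sin_pi_sub, hc6, hs6, hexShear, hexVertex, mulVec, dotProduct, Fin.sum_univ_two]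
  · ext t; fin_cases t <;> simp [RegularPolygon.vertex, e3, Real.cos_add_pi, Real.sin_add_pi, hc6, hs6, hexShear, hexVertex, mulVec, dotProduct, Fin.sum_univ_two]
  · ext t; fin_cases t <;> simp [RegularPolygon.vertex, e4, Real.cos_add_pi, Real.sin_add_pi, hexShear, hexVertex, mulVec, dotProduct, Fin.sum_univ_two]; ring
  · ext t; fin_cases t <;> simp [RegularPolygon.vertex, e5, Real.cos_add_two_pi, Real.sin_add_two_pi, Real.cos_neg, Real.sin_neg, hc6, hs6, hexShear, hexVertex, mulVec, dotProduct, Fin.sum_univ_two]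

/-- Slack matrices: regular hexagon = `(√3/2)` × lattice hexagon. [cite: GouchaGouveiaSilva2017, Rem. 4.8 (p09)] -/
theorem RegularPolygon.polygonSlack_vertex_six (i j : Fin 6) :
    polygonSlack (RegularPolygon.vertex 6) i j = Real.sqrt 3 / 2 * polygonSlack hexVertex i j := by
  rw [show RegularPolygon.vertex 6 = fun k => hexShear *ᵥ hexVertex k from funext RegularPolygon.vertex_six_eq,
    polygonSlack_mulVec, det_hexShear]


/-- Positive rescaling preserves complex psd factorizations of a given size (scale the `B_j`).
[cite: GouchaGouveiaSilva2017, §1 (p03, "the slack matrix of `P` is defined only up to scaling")] -/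
theorem HasComplexPsdFactorization.smul {ι κ : Type*} {M : ι → κ → ℝ} {r : ℕ}
    (h : HasComplexPsdFactorization M r) {c : ℝ} (hc : 0 ≤ c) :
    HasComplexPsdFactorization (fun i j => c * M i j) r := by
  obtain ⟨A, B, hA, hB, hM⟩ := h
  refine ⟨A, fun j => (c : ℂ) • B j, hA, fun j => (hB j).smul (Complex.zero_le_real.mpr hc),
    fun i j => ?_⟩
  change (((c * M i j : ℝ)) : ℂ) = (A i * ((c : ℂ) • B j)).trace
  rw [Matrix.mul_smul, trace_smul, ← hM, smul_eq_mul, Complex.ofReal_mul]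

/-- **GGS Remark 4.8 for the Euclidean regular hexagon** `X_6 = {(cos θ_i, sin θ_i)}` (the tree's
`RegularPolygon.vertex 6`, an affine image of the lattice hexagon: `polygonSlack_vertex_six`): its
slack matrix has COMPLEX psd rank exactly `3` ("this polygon is `ℂ`-psd-minimal") and REAL psd rank
exactly `4`. [cite: GouchaGouveiaSilva2017, Rem. 4.8 (p09)] -/
theorem RegularPolygon.regularHexagon_complexPsdRank :
    (HasComplexPsdFactorization (polygonSlack (RegularPolygon.vertex 6)) 3 ∧
      ¬ HasComplexPsdFactorization (polygonSlack (RegularPolygon.vertex 6)) 2) ∧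
    (HasPsdFactorization (polygonSlack (RegularPolygon.vertex 6)) 4 ∧
      ¬ HasPsdFactorization (polygonSlack (RegularPolygon.vertex 6)) 3) := by
  have hconv : IsConvexPolygon (RegularPolygon.vertex 6) :=
    RegularPolygon.isConvexPolygon_vertex (by norm_num)
  refine ⟨⟨?_, fun h => absurd (hconv.three_le_of_hasComplexPsdFactorization (by norm_num) h)
    (by norm_num)⟩, hconv.psdRank_hexagon⟩
  have h := hasComplexPsdFactorization_hexVertex_three.smul (c := Real.sqrt 3 / 2) (by positivity)
  have hfun : (polygonSlack (RegularPolygon.vertex 6) : Fin 6 → Fin 6 → ℝ) =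
      fun i j => Real.sqrt 3 / 2 * polygonSlack hexVertex i j :=
    funext fun i => funext fun j => RegularPolygon.polygonSlack_vertex_six i j
  rw [hfun]
  exact h

end RegularHexagon

/-! ### Basic properties of complex psd factorizations -/

/-- Transposition: exchange the roles of the factors (`tr(AB) = tr(BA)`).
[cite: LeeWeiDeWolf2017, §2 (p05, Def. 1)] -/
theorem HasComplexPsdFactorization.transpose {ι κ : Type*} {M : ι → κ → ℝ} {r : ℕ}
    (h : HasComplexPsdFactorization M r) : HasComplexPsdFactorization (fun j i => M i j) r := by
  obtain ⟨A, B, hA, hB, hM⟩ := h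
  exact ⟨B, A, hB, hA, fun j i => by rw [hM i j, Matrix.trace_mul_comm]⟩

/-- Submatrices inherit complex psd factorizations. [cite: LeeWeiDeWolf2017, §2 (p05, Def. 1)] -/
theorem HasComplexPsdFactorization.submatrix {ι κ ι' κ' : Type*} {M : ι → κ → ℝ} {r : ℕ}
    (h : HasComplexPsdFactorization M r) (f : ι' → ι) (g : κ' → κ) :
    HasComplexPsdFactorization (fun i j => M (f i) (g j)) r := by
  obtain ⟨A, B, hA, hB, hM⟩ := h
  exact ⟨fun i => A (f i), fun j => B (g j), fun i => hA _, fun j => hB _, fun i j => hM _ _⟩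

/-- **`rank M ≤ (rank_psd^ℂ M)²`** (Lee–Wei–de Wolf Fact 4, p05: "`rank_psd(A) ≥ B₁(A) = √rank(A)`",
after [GPT11]): a complex psd factorization of size `r` is an ordinary factorization through the `r²`
REAL coordinates `Re A_{st}` (`s ≤ t`) and `Im A_{st}` (`s < t`) of a Hermitian matrix:
`tr(A B) = Σ_s A_{ss}B_{ss} + 2Σ_{s<t}(Re A_{st} Re B_{st} + Im A_{st} Im B_{st})`.
[cite: LeeWeiDeWolf2017, Fact 4 (p05)] -/
theorem HasComplexPsdFactorization.rank_le_sq {ι κ : Type} [Fintype ι] [Fintype κ]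
    {M : Matrix ι κ ℝ} {r : ℕ} (h : HasComplexPsdFactorization M r) : M.rank ≤ r ^ 2 := by
  classical
  obtain ⟨A, B, hA, hB, hM⟩ := h
  -- Hermitian symmetries
  have hAh : ∀ i s t, A i t s = star (A i s t) := fun i s t => by
    simpa using ((hA i).1.apply t s).symm
  have hBh : ∀ j s t, B j t s = star (B j s t) := fun j s t => by
    simpa using ((hB j).1.apply t s).symm
  -- the real coordinates
  let U : Matrix ι (Fin r × Fin r) ℝ := fun i p =>
    if p.1 ≤ p.2 then (A i p.1 p.2).re else (A i p.2 p.1).im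
  let V : Matrix (Fin r × Fin r) κ ℝ := fun p j =>
    if p.1 < p.2 then 2 * (B j p.1 p.2).re else if p.1 = p.2 then (B j p.1 p.1).re
      else 2 * (B j p.2 p.1).im
  -- `M_{ij} = Re tr(A_i B_j) = Σ_{s,t} g(s,t)` with `g(s,t) = Re A_st Re B_st + Im A_st Im B_st`
  have hg : ∀ i j, M i j = ∑ p : Fin r × Fin r,
      ((A i p.1 p.2).re * (B j p.1 p.2).re + (A i p.1 p.2).im * (B j p.1 p.2).im) := by
    intro i j
    have h1 : M i j = ((A i * B j).trace).re := by rw [← hM i j, Complex.ofReal_re]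
    rw [h1]
    simp only [Matrix.trace, Matrix.diag_apply, Matrix.mul_apply, Complex.re_sum, Complex.mul_re]
    rw [← Finset.univ_product_univ, Finset.sum_product]
    refine Finset.sum_congr rfl fun s _ => Finset.sum_congr rfl fun t _ => ?_
    rw [hBh j s t]
    simp only [Complex.star_def, Complex.conj_re, Complex.conj_im]
    ring
  -- regroup: the summand `g` is symmetric and `Im A_ss = 0`
  have hsym : ∀ i j (s t : Fin r),
      (A i t s).re * (B j t s).re + (A i t s).im * (B j t s).im =
        (A i s t).re * (B j s t).re + (A i s t).im * (B j s t).im := by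
    intro i j s t
    rw [hAh i s t, hBh j s t]
    simp only [Complex.star_def, Complex.conj_re, Complex.conj_im]
    ring
  have hdiag : ∀ i (s : Fin r), (A i s s).im = 0 := fun i s => by
    have := congrArg Complex.im (hAh i s s)
    simp only [Complex.star_def, Complex.conj_im] at this
    linarith
  have hUV : M = U * V := by
    ext i j
    rw [hg i j, Matrix.mul_apply]
    let g : Fin r × Fin r → ℝ := fun p =>
      (A i p.1 p.2).re * (B j p.1 p.2).re + (A i p.1 p.2).im * (B j p.1 p.2).im
    let uv : Fin r × Fin r → ℝ := fun p => U i p * V p j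
    -- split according to `s < t`, `s = t`, `s > t`: each unordered pair contributes equally
    have key : ∀ p : Fin r × Fin r, g p + g (p.2, p.1) = uv p + uv (p.2, p.1) := by
      rintro ⟨s, t⟩
      simp only [g, uv, U, V]
      rcases lt_trichotomy s t with hst | rfl | hts
      · rw [if_pos hst.le, if_pos hst, if_neg (not_le.mpr hst), if_neg (not_lt.mpr hst.le),
          if_neg (ne_of_gt hst), hsym i j s t]
        ring
      · rw [if_pos le_rfl, if_neg (lt_irrefl _), if_pos rfl, hdiag i s]
        ring
      · rw [if_neg (not_le.mpr hts), if_neg (not_lt.mpr hts.le), if_neg (ne_of_gt hts),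
          if_pos hts.le, if_pos hts, hsym i j t s]
        ring
    have hswap : ∀ f : Fin r × Fin r → ℝ, ∑ p : Fin r × Fin r, f (p.2, p.1) = ∑ p, f p := fun f =>
      Fintype.sum_equiv (Equiv.prodComm _ _) _ _ fun p => rfl
    have hL : ∑ p : Fin r × Fin r, g p + ∑ p : Fin r × Fin r, g (p.2, p.1) =
        ∑ p : Fin r × Fin r, uv p + ∑ p : Fin r × Fin r, uv (p.2, p.1) := by
      rw [← Finset.sum_add_distrib, ← Finset.sum_add_distrib]
      exact Finset.sum_congr rfl fun p _ => key p
    rw [hswap g, hswap uv] at hL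
    show ∑ p : Fin r × Fin r, g p = ∑ p : Fin r × Fin r, uv p
    linarith
  calc M.rank = (U * V).rank := by rw [hUV]
    _ ≤ U.rank := Matrix.rank_mul_le_left _ _
    _ ≤ Fintype.card (Fin r × Fin r) := Matrix.rank_le_card_width _
    _ = r ^ 2 := by simp [sq]

/-! ### Realification: real psd rank ≤ 2 · complex psd rank -/

/-- **Real psd rank ≤ 2 × complex psd rank** (Lee–Wei–de Wolf, p03: "It is easy to see that the real
PSD-rank can be at most a factor of 2 larger than the complex PSD-rank"): realify all factors by
`T(H) = [[Re H, −Im H], [Im H, Re H]]` (the tree's `posSemidef_realify`, `trace_realify_mul_realify`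
of `CompletelyPsdRank.lean`, PSVW §3.1), `M_{ij} = tr(T(A_i) · ½T(B_j))`, and reindex
`Fin r ⊕ Fin r ≃ Fin (r + r)`. [cite: LeeWeiDeWolf2017, §1 (p03)] -/
theorem HasComplexPsdFactorization.toReal {ι κ : Type*} {M : ι → κ → ℝ} {r : ℕ}
    (h : HasComplexPsdFactorization M r) : HasPsdFactorization M (r + r) := by
  obtain ⟨A, B, hA, hB, hM⟩ := h
  let T : Matrix (Fin r) (Fin r) ℂ → Matrix (Fin r ⊕ Fin r) (Fin r ⊕ Fin r) ℝ := fun H =>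
    Matrix.fromBlocks (H.map Complex.re) (-(H.map Complex.im)) (H.map Complex.im) (H.map Complex.re)
  let e : Fin r ⊕ Fin r ≃ Fin (r + r) := finSumFinEquiv
  refine ⟨fun i => (T (A i)).submatrix e.symm e.symm,
    fun j => ((1 / 2 : ℝ) • T (B j)).submatrix e.symm e.symm,
    fun i => (posSemidef_realify (hA i)).submatrix e.symm,
    fun j => ((posSemidef_realify (hB j)).smul (by norm_num)).submatrix e.symm, fun i j => ?_⟩
  have htr : ∀ C : Matrix (Fin r ⊕ Fin r) (Fin r ⊕ Fin r) ℝ,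
      (C.submatrix e.symm e.symm).trace = C.trace := fun C => by
    simp only [Matrix.trace, Matrix.diag_apply, Matrix.submatrix_apply]
    exact Fintype.sum_equiv e.symm _ _ fun x => rfl
  change M i j = ((T (A i)).submatrix e.symm e.symm *
    ((1 / 2 : ℝ) • T (B j)).submatrix e.symm e.symm).trace
  rw [Matrix.submatrix_mul_equiv, htr, Matrix.mul_smul, trace_smul]
  simp only [T]
  rw [trace_realify_mul_realify, ← hM i j, Complex.ofReal_re, smul_eq_mul]
  ring

/-! ### FGPRT §2.2: the Hermitian psd rank of the `4 × 4` derangement matrix is `2` < `3` (appended)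

FGPRT p06 (verbatim): "It is also natural to consider a related notion of psd rank where the factors
[...] are positive semidefinite Hermitian matrices. Denote by `rank_psd^ℂ(M)` the associated psd rank.
[...] `rank_psd^ℂ(M) ≤ rank_psd(M) ≤ 2 rank_psd^ℂ(M)` [...] One can show that the Hermitian psd rank
can be strictly smaller than the real psd rank. Consider the `4 × 4` derangement matrix [...] Using
the inequalities (1) one can show that `rank_psd(M) ≥ 3`. However one can find a psd factorization of
`M` with Hermitian matrices of size 2, as given below: `A_1 = [1 0; 0 0]`, `A_2 = [0 0; 0 1]`,
`A_3 = [1 −1; −1 1]`, `A_4 = [1 e^{2iπ/3}; e^{−2iπ/3} 1]`, `B_1 = [0 0; 0 1]`, `B_2 = [1 0; 0 0]`,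
`B_3 = [1 1; 1 1]`, `B_4 = [1 −e^{2iπ/3}; −e^{−2iπ/3} 1]`." All eight factors are rank one:
`A_i = ū_iū_i^*` with `u = (1,0), (0,1), (1,−1), (1,ω)` and `B_j = v_jv_j^*` with
`v = (0,1), (1,0), (1,1), (1,−ω̄)`, `ω = e^{2πi/3}`, so the check
`Tr(A_iB_j) = |u_i · v_j|² = D_4(i,j)` is `HasComplexPsdFactorization.of_normSq`. -/

/-- `ω = e^{2πi/3} = −1/2 + (√3/2)i`. [cite: FawziEtAl2015, §2.2 (p06, e^{2iπ/3})] -/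
def omega3 : ℂ := ⟨-1 / 2, Real.sqrt 3 / 2⟩

/-- `|ω|² = 1`. [cite: FawziEtAl2015, §2.2 (p06)] -/
theorem normSq_omega3 : Complex.normSq omega3 = 1 := by
  rw [omega3, Complex.normSq_mk]
  have h3 : Real.sqrt 3 * Real.sqrt 3 = 3 := Real.mul_self_sqrt (by norm_num)
  nlinarith [h3]

/-- The vectors `u_i` with `A_i = ū_i ū_i^*`: `(1,0), (0,1), (1,−1), (1,ω)` (so `A_4 = [1 ω; ω̄ 1]`).
[cite: FawziEtAl2015, §2.2 (p06, A_1..A_4)] -/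
def derangementRowVec : Fin 4 → Fin 2 → ℂ :=
  ![![1, 0], ![0, 1], ![1, -1], ![1, omega3]]

/-- The vectors `v_j` with `B_j = v_j v_j^*`: `(0,1), (1,0), (1,1), (1,−ω̄)` (so `B_4 = [1 −ω; −ω̄ 1]`).
[cite: FawziEtAl2015, §2.2 (p06, B_1..B_4)] -/
def derangementColVec : Fin 4 → Fin 2 → ℂ :=
  ![![0, 1], ![1, 0], ![1, 1], ![1, -(starRingEnd ℂ) omega3]]

/-- The printed factorization checks: `D_4(i,j) = Tr(A_iB_j) = |u_i · v_j|²` (sixteen identities;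
`|ω| = |1 + ω| = |1 + ω̄| = 1`, `1 − ωω̄ = 0`). [cite: FawziEtAl2015, §2.2 (p06)] -/
theorem derangementMatrix_four_eq_normSq (i j : Fin 4) :
    derangementMatrix 4 i j = Complex.normSq (derangementRowVec i ⬝ᵥ derangementColVec j) := by
  have h3 : Real.sqrt 3 * Real.sqrt 3 = 3 := Real.mul_self_sqrt (by norm_num)
  have hω : Complex.normSq omega3 = 1 := normSq_omega3
  have hωω : omega3 * (starRingEnd ℂ) omega3 = 1 := by rw [Complex.mul_conj, hω]; simp
  have h1ω : Complex.normSq (1 + omega3) = 1 := by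
    rw [omega3, show (1 : ℂ) + ⟨-1 / 2, Real.sqrt 3 / 2⟩ = ⟨1 / 2, Real.sqrt 3 / 2⟩ by
      apply Complex.ext <;> norm_num, Complex.normSq_mk]
    nlinarith [h3]
  have h1ωc : Complex.normSq (1 + (starRingEnd ℂ) omega3) = 1 := by
    rw [← Complex.normSq_conj, map_add, map_one, Complex.conj_conj, h1ω]
  fin_cases i <;> fin_cases j <;>
    simp [derangementMatrix, derangementRowVec, derangementColVec, dotProduct, Fin.sum_univ_two, hω, hωω,
      h1ω, h1ωc]

/-- **`rank_psd^ℂ(D_4) ≤ 2`**: the printed Hermitian factorization of size `2`.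
[cite: FawziEtAl2015, §2.2 (p06)] -/
theorem hasComplexPsdFactorization_derangementMatrix_four :
    HasComplexPsdFactorization (derangementMatrix 4) 2 :=
  HasComplexPsdFactorization.of_normSq derangementRowVec derangementColVec derangementMatrix_four_eq_normSq

/-- `det D_4 = −3`. [cite: FawziEtAl2015, §2.2 (p06) with Ex. 5.1 (p14)] -/
theorem det_derangementMatrix_four : (derangementMatrix 4).det = -3 := by
  rw [show derangementMatrix 4 = Matrix.of fun i j : Fin 4 => if i = j then (0:ℝ) else 1 from rfl]
  simp [Matrix.det_succ_row_zero, Fin.sum_univ_succ, Matrix.submatrix_apply, Fin.succAbove]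
  norm_num

/-- **`rank_psd^ℂ(D_4) ≥ 2`**: `rank D_4 = 4 > 1²` (Fact `rank ≤ (rank_psd^ℂ)²`,
`HasComplexPsdFactorization.rank_le_sq`). [cite: FawziEtAl2015, §2.2 (p06) with Prop. 2.5 (p05)] -/
theorem two_le_of_hasComplexPsdFactorization_derangementMatrix_four {r : ℕ}
    (h : HasComplexPsdFactorization (derangementMatrix 4) r) : 2 ≤ r := by
  have hrank : (derangementMatrix 4).rank = 4 := by
    have hu : IsUnit (derangementMatrix 4) :=
      (Matrix.isUnit_iff_isUnit_det _).mpr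
        (isUnit_iff_ne_zero.mpr (by rw [det_derangementMatrix_four]; norm_num))
    simpa using Matrix.rank_of_isUnit _ hu
  have hle := h.rank_le_sq
  rw [hrank] at hle
  by_contra hr
  have : r ≤ 1 := by omega
  have : r ^ 2 ≤ 1 := by nlinarith
  omega

/-- **FGPRT §2.2: `rank_psd^ℂ(D_4) = 2 < 3 = rank_psd(D_4)`** — the Hermitian psd rank can be strictly
smaller than the real one: `D_4` has a Hermitian factorization of size `2` and none smaller, while
its real psd factorizations have exactly the sizes `≥ 3` (FGPRT Example 5.1,
`FawziEtAl2015_ex51_holds`: size `k ≥ 1` iff `4 ≤ C(k+1,2)`). [cite: FawziEtAl2015, §2.2 (p06)] -/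
theorem FawziEtAl2015_sec22_derangement :
    (HasComplexPsdFactorization (derangementMatrix 4) 2 ∧
      ∀ r, HasComplexPsdFactorization (derangementMatrix 4) r → 2 ≤ r) ∧
    (¬ HasPsdFactorization (derangementMatrix 4) 2 ∧ HasPsdFactorization (derangementMatrix 4) 3) :=
  ⟨⟨hasComplexPsdFactorization_derangementMatrix_four,
    fun _ h => two_le_of_hasComplexPsdFactorization_derangementMatrix_four h⟩,
   fun h => absurd ((FawziEtAl2015_ex51_holds 4 2 (by norm_num)).mp h) (by decide),
   (FawziEtAl2015_ex51_holds 4 3 (by norm_num)).mpr (by decide)⟩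

end Literature.Combinatorics.Optimization
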